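import Summits.BirchSwinnertonDyer.Rank1Residual.X11b.RungK2Leaves

/-!
# Rung-K2 import hub for ledger route files (D-0059 ∕ D-0061; cell bsd-stepL, planner g18, 2026-08-25)

Gate-rendered route files (`Summits/<P>/<Sub>/Theses/*.lean`) may import only Mathlib ∕ Literature ∕
HarnessLib ∕ `Summits.<P>.Statement` ∕ `Summits.<P>.<Sub>.Theorems.*` (observed: `ledger route check
--native` refuses `Summits.BirchSwinnertonDyer.Rank1Residual.*`). The rung-K2 leaves
`X11b.MultiplicativeRankOne` ∕ `X11b.MultiplicativeRankOneAtThree` (`X11b/RungK2Leaves.lean`, p404842) and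
the typed residual objects of class X11b they are assembled from live under
`Summits.BirchSwinnertonDyer.Rank1Residual.*`. This THEOREMS module is the import hub: its import closure
(`RungK2Leaves` ⊇ `BDPRouteEndState`, `Three/ClassRecordEP`, the partition rows, every Literature fact
they consume) is what the routes `ErratumRoadFive` (K2a) and `ClassRecordThree` (K2b) state their cruxes
over. Content: the two definitional unfolding lemmas of the leaves — nothing is asserted.
-/

namespace Summit.BirchSwinnertonDyer.Rank1Residual.X11b

open Literature.NumberTheory.EllipticCurves

/-- Unfolding of the rung-K2a leaf: BSD(E,p) on all of class X11b at `p ≥ 5`. [folklore] -/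
theorem multiplicativeRankOne_iff :
    MultiplicativeRankOne ↔
      ∀ (W : WeierstrassCurve ℚ) [W.IsElliptic] [W.IsGloballyMinimal] (p : ℕ) [Fact p.Prime],
        ClassX11b W p → 5 ≤ p → BSDp W p :=
  Iff.rfl

/-- Unfolding of the rung-K2b leaf: BSD(E,3) on all of class X11b at `p = 3`. [folklore] -/
theorem multiplicativeRankOneAtThree_iff :
    MultiplicativeRankOneAtThree ↔
      ∀ (W : WeierstrassCurve ℚ) [W.IsElliptic] [W.IsGloballyMinimal], ClassX11b W 3 → BSDp W 3 :=
  Iff.rfl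

end Summit.BirchSwinnertonDyer.Rank1Residual.X11b
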